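import Summits.Ventures.QEC.Census.BB.SD8lc_n114_k6_a70ace25
import Summits.Ventures.QEC.Census.BB.SD8lc_n120_k8_a89da712
import Summits.Ventures.QEC.Census.BB.SD8lc_n130_k10_8438ec22
import Summits.Ventures.QEC.Census.BB.SD8lc_n132_k8_57db3d9b.Distance
import Summits.Ventures.QEC.Census.BB.BBRows
import Summits.Ventures.QEC.Census.BB.Claims
import Literature.InformationTheory.QuantumCodes.TwoBlockConnectedComponents
import Literature.InformationTheory.QuantumCodes.TwoBlockToricLayout
import Literature.InformationTheory.QuantumCodes.TwoBlockWheelComponents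
import Literature.InformationTheory.QuantumCodes.TwoBlockRootParameters
import HarnessLib
import HarnessLib.Audit.Tags

/-!
# Census rows as TYPED two-block codes `QC(A, B)` on `ℤ_ℓ × ℤ_m` — bridge batch `BridgeBatch6QC08` (4 row(s), kernel tier)

Family: abelian two-block over ℤ_ℓ × ℤ_m (qec census one-module KERNEL-std rows: qec-search-7 certificate modules, MITM and
Brouwer–Zimmermann/automorphism formats). For each census row below (an EXPLICIT matrix code
`cert.code _ = CSSCode.ofMatrices (rowMatrix n cert.HX) (rowMatrix n cert.HZ)` with `IsCode n k d` certified in its own module), this file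
puts the row's CONSTRUCTION into the kernel statement, as in the pilot `Census/BB/A1s_n144_k32_4addf704QC.lean` (p511732) and the
gen-4 batches `A1sRowsQC1–5` / `TwoBGARowsQC1–4`: monomial lists `la`, `lb` (from the certificate's construction record — the
docstring's `A_terms`/`B_terms` or the census row id `2bga-lℓmm-A…-B…`, monomials `xⁱyʲ` as `[i,j]`, convention of BCGMRY24 §4 =
`BivariateBicycleCodes.lean`; the index identity was ALSO re-verified row-for-row by the emitter before filing), the typed object
`qc : BB.Code ℓ m := ⟨polyL la, polyL lb⟩`, the kernel INDEX IDENTITIES `cert.HX = BBRows.rowsX la lb`, `cert.HZ = BBRows.rowsZ la lb`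
(`decide`; verified row generator `Census/BB/BBRows.lean`, p502918), the flat identities via `BBRows.rowMatrix_rowsX/Z`, the transport of
the row's own `dZ_eq` and `k` (its `k_eq`, or the `k`-component of its `isCode`) by type-05's `BB.Code.dZ_eq_of_flat` / `k_eq_of_flat` to
`qc_hasParams : BB.HasParams qc n k d` (census predicate of family BB, `Census/BB/Claims.lean`, distance EXACT) and
`qc_isCode : qc.css.IsCode n k d`; and the census LAYOUT columns (Bravyi et al. 2024 §4 — arXiv:2308.07915: Lemma 2 p0010 L49, Lemma 3 p0011 L9, Lemma 4 p0011 L28; locators per qec-ref-2 2026-08-27T10:27Z) as KERNEL verdicts: «connected» —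
`qc_tannerGraph_connected` (Lemma 3, `BB.Code.tannerGraph_connected_of_unit_mem`, explicit multiples of exponent differences) or
`qc_tannerGraph_not_connected` + `card_expDiffSubgroup` + `qc_card_connectedComponent` (`⟨S⟩` = an explicit finite carrier `diffList`,
both inclusions certified; exact component count by Lemma 3 (ii), `BB.Code.card_connectedComponent_mul_card`; by the tree's connected
normal form `TwoBlockConnectedComponents.lean` such a code is the disjoint union of that many copies of its root code, whose parameters
`[[n/c, k/c, d]]` and connectedness are certified here as `root_isCode` via `TwoBlockRootParameters.lean`); «toric layout» —
`qc_hasToricLayoutWith μ λ` (Lemma 4, `BB.Code.hasToricLayoutWith_of_exponents`; omitted when its sufficient condition has no witness);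
«wheel layers» — `qc_wheel_layers` (Lemma 2 minus planarity, `BB.Code.exists_wheel_layers`, weight-(3,3) rows only):

* `SD8lc_n114_k6_a70ace25` = `QC(1 + y + y^3 + y^25, 1 + y^32 + y^54 + y^56)` on `ℤ_1 × ℤ_57`: `[[114, 6, 10]]`; Tanner graph connected
* `SD8lc_n120_k8_a89da712` = `QC(1 + y + y^4 + xy^9, 1 + y^26 + y^29 + xy^21)` on `ℤ_2 × ℤ_30`: `[[120, 8, 12]]`; Tanner graph connected; toric layout (10,6)
* `SD8lc_n130_k10_8438ec22` = `QC(1 + y + y^6 + y^25, 1 + y^40 + y^59 + y^64)` on `ℤ_1 × ℤ_65`: `[[130, 10, 10]]`; Tanner graph connected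
* `SD8lc_n132_k8_57db3d9b` = `QC(1 + y + y^4 + y^15, 1 + y^51 + y^62 + y^65)` on `ℤ_1 × ℤ_66`: `[[132, 8, 12]]`; Tanner graph connected

No new certificate — tier KERNEL, axioms standard, no `native_decide`. HONEST FRAMING: identifies already-certified census objects with
named algebraic constructions and decides structural (graph) properties; the census comparator columns (printed values, optimality
words) are not touched; for disconnected rows the root code is identified abstractly over `↥⟨S⟩` (not re-indexed to a named `QC(A',B')`,
not identified with a smaller census row); planarity/thickness is not asserted. Generated by
qec-type-05 gen 6's `tools/emit_qc_bridge3.py` (gen 5's emitter + sibling-data rows + ℓ = 1 connectivity) + `tools/conn_cert.py` (HOME/lean/type-05/tools/).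
-/

namespace Summit.Ventures.QEC.Census.SD8lc_n114_k6_a70ace25

open Matrix Literature.InformationTheory.QuantumCodes BBRows

/-- Monomials of `A = 1 + y + y^3 + y^25` (construction `A_terms = [[0, 0], [0, 1], [0, 3], [0, 25]]`, from the census generator file `census/search-3/gens/sd8/SD8lc_n114_k6_a70ace25.json` (matrix_sha256 `a70ace253396bd67…`; `A = 1+y+y^3+y^25`, `B = 1+y^32+y^54+y^56`)). DATA. -/
def la : List (BB.Mono 1 57) := [(Fin.ofNat 1 0, Fin.ofNat 57 0), (Fin.ofNat 1 0, Fin.ofNat 57 1), (Fin.ofNat 1 0, Fin.ofNat 57 3), (Fin.ofNat 1 0, Fin.ofNat 57 25)]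

/-- Monomials of `B = 1 + y^32 + y^54 + y^56` (construction `B_terms = [[0, 0], [0, 32], [0, 54], [0, 56]]`). DATA. -/
def lb : List (BB.Mono 1 57) := [(Fin.ofNat 1 0, Fin.ofNat 57 0), (Fin.ofNat 1 0, Fin.ofNat 57 32), (Fin.ofNat 1 0, Fin.ofNat 57 54), (Fin.ofNat 1 0, Fin.ofNat 57 56)]

/-- The census row's code as a TYPED two-block code `QC(1 + y + y^3 + y^25, 1 + y^32 + y^54 + y^56)` on `ℤ_1 × ℤ_57` (`BB.Code 1 57`). (definition) -/
def qc : BB.Code 1 57 := ⟨polyL la, polyL lb⟩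

set_option maxRecDepth 100000 in
/-- INDEX IDENTITY, `X` side, in the kernel: the certificate's `H^X` rows ARE the `X`-check words of `qc` (`decide +kernel`). -/
theorem HX_eq_rowsX : SD8lc_n114_k6_a70ace25.cert.HX = rowsX la lb := by
  decide +kernel

set_option maxRecDepth 100000 in
/-- INDEX IDENTITY, `Z` side. -/
theorem HZ_eq_rowsZ : SD8lc_n114_k6_a70ace25.cert.HZ = rowsZ la lb := by
  decide +kernel

set_option maxRecDepth 100000 in
/-- The certificate's flat `H^X` is `qc.HXFlat`. -/
theorem rowMatrix_HX_eq : rowMatrix 114 SD8lc_n114_k6_a70ace25.cert.HX = qc.HXFlat := by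
  have cast : ∀ {H H' : List ℕ} (e : H = H'),
      rowMatrix 114 H = (rowMatrix 114 H').submatrix (Fin.cast (congrArg List.length e)) id := by
    intro H H' e; subst e; rfl
  exact (cast HX_eq_rowsX).trans (rowMatrix_rowsX qc (LA := la) (LB := lb) rfl rfl)

set_option maxRecDepth 100000 in
/-- The certificate's flat `H^Z` is `qc.HZFlat`. -/
theorem rowMatrix_HZ_eq : rowMatrix 114 SD8lc_n114_k6_a70ace25.cert.HZ = qc.HZFlat := by
  have cast : ∀ {H H' : List ℕ} (e : H = H'),
      rowMatrix 114 H = (rowMatrix 114 H').submatrix (Fin.cast (congrArg List.length e)) id := by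
    intro H H' e; subst e; rfl
  exact (cast HZ_eq_rowsZ).trans (rowMatrix_rowsZ qc (LA := la) (LB := lb) rfl rfl)

set_option maxRecDepth 100000 in
/-- `d^Z (qc) = 10`, transported from the census certificate (`SD8lc_n114_k6_a70ace25.dZ_eq`) by `BB.Code.dZ_eq_of_flat`. -/
theorem qc_dZ : qc.css.dZ = 10 :=
  (qc.dZ_eq_of_flat (D := SD8lc_n114_k6_a70ace25.cert.code (SD8lc_n114_k6_a70ace25.cert.commOK_of_checkStructure SD8lc_n114_k6_a70ace25.checkStructure_ok))
    rowMatrix_HX_eq rowMatrix_HZ_eq).symm.trans SD8lc_n114_k6_a70ace25.dZ_eq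

set_option maxRecDepth 100000 in
/-- `k (qc) = 6`, transported from the census certificate (`SD8lc_n114_k6_a70ace25.k_eq`) by `BB.Code.k_eq_of_flat`. -/
theorem qc_k : qc.k = 6 :=
  (qc.k_eq_of_flat (D := SD8lc_n114_k6_a70ace25.cert.code (SD8lc_n114_k6_a70ace25.cert.commOK_of_checkStructure SD8lc_n114_k6_a70ace25.checkStructure_ok))
    rowMatrix_HX_eq rowMatrix_HZ_eq).symm.trans SD8lc_n114_k6_a70ace25.k_eq

/-- **`QC(1 + y + y^3 + y^25, 1 + y^32 + y^54 + y^56)` on `ℤ_1 × ℤ_57` has parameters `[[114, 6, 10]]`** (distance exact; `BB.HasParams`) — the census row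
`SD8lc_n114_k6_a70ace25` read as a statement about the construction. KERNEL. -/
theorem qc_hasParams : Summit.Ventures.QEC.BB.HasParams qc 114 6 10 :=
  BB.hasParams_of_dZ (by simp only [BB.numQubits_eq]) qc_k qc_dZ

/-- The same in the generic census vocabulary: `qc.css.IsCode 114 6 10`. -/
theorem qc_isCode : qc.css.IsCode 114 6 10 :=
  (BB.hasParams_iff_isCode (by decide)).1 qc_hasParams

set_option maxRecDepth 100000 in
/-- **The Tanner graph of `qc` is connected** (Bravyi et al. 2024 Lemma 3 / `BB.Code.tannerGraph_connected_of_unit_mem`): `x = (1,0)`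
and `y = (0,1)` are explicit combinations of exponent differences inside `A` or inside `B` (found by qec-type-05's tools/conn_cert.py,
re-checked by `decide`). Census column «connected» for this row, KERNEL. -/
theorem qc_tannerGraph_connected : qc.css.tannerGraph.Connected := by
  refine qc.tannerGraph_connected_of_unit_mem (fun h => absurd (congrFun h ((0 : Fin 1), (0 : Fin 57))) (by decide))
    (fun h => absurd (congrFun h ((0 : Fin 1), (0 : Fin 57))) (by decide)) ?_ ?_
  · have e : (((1 : Fin 1), (0 : Fin 57)) : BB.Mono 1 57) = (57 : ℕ) • ((((0 : Fin 1), (0 : Fin 57))) - (0, 1)) := by decide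
    rw [e]
    exact (AddSubgroup.nsmul_mem _ (qc.sub_mem_expDiffSubgroup_A (by decide) (by decide)) 57)
  · have e : (((0 : Fin 1), (1 : Fin 57)) : BB.Mono 1 57) = (56 : ℕ) • ((((0 : Fin 1), (0 : Fin 57))) - (0, 1)) := by decide
    rw [e]
    exact (AddSubgroup.nsmul_mem _ (qc.sub_mem_expDiffSubgroup_A (by decide) (by decide)) 56)

end Summit.Ventures.QEC.Census.SD8lc_n114_k6_a70ace25

namespace Summit.Ventures.QEC.Census.SD8lc_n120_k8_a89da712

open Matrix Literature.InformationTheory.QuantumCodes BBRows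

/-- Monomials of `A = 1 + y + y^4 + xy^9` (construction `A_terms = [[0, 0], [0, 1], [0, 4], [1, 9]]`, from the census generator file `census/search-3/gens/sd8/SD8lc_n120_k8_a89da712.json` (matrix_sha256 `a89da71229867dce…`; `A = 1+y+y^4+x*y^9`, `B = 1+y^26+y^29+x*y^21`)). DATA. -/
def la : List (BB.Mono 2 30) := [(Fin.ofNat 2 0, Fin.ofNat 30 0), (Fin.ofNat 2 0, Fin.ofNat 30 1), (Fin.ofNat 2 0, Fin.ofNat 30 4), (Fin.ofNat 2 1, Fin.ofNat 30 9)]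

/-- Monomials of `B = 1 + y^26 + y^29 + xy^21` (construction `B_terms = [[0, 0], [0, 26], [0, 29], [1, 21]]`). DATA. -/
def lb : List (BB.Mono 2 30) := [(Fin.ofNat 2 0, Fin.ofNat 30 0), (Fin.ofNat 2 0, Fin.ofNat 30 26), (Fin.ofNat 2 0, Fin.ofNat 30 29), (Fin.ofNat 2 1, Fin.ofNat 30 21)]

/-- The census row's code as a TYPED two-block code `QC(1 + y + y^4 + xy^9, 1 + y^26 + y^29 + xy^21)` on `ℤ_2 × ℤ_30` (`BB.Code 2 30`). (definition) -/
def qc : BB.Code 2 30 := ⟨polyL la, polyL lb⟩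

set_option maxRecDepth 100000 in
/-- INDEX IDENTITY, `X` side, in the kernel: the certificate's `H^X` rows ARE the `X`-check words of `qc` (`decide +kernel`). -/
theorem HX_eq_rowsX : SD8lc_n120_k8_a89da712.cert.HX = rowsX la lb := by
  decide +kernel

set_option maxRecDepth 100000 in
/-- INDEX IDENTITY, `Z` side. -/
theorem HZ_eq_rowsZ : SD8lc_n120_k8_a89da712.cert.HZ = rowsZ la lb := by
  decide +kernel

set_option maxRecDepth 100000 in
/-- The certificate's flat `H^X` is `qc.HXFlat`. -/
theorem rowMatrix_HX_eq : rowMatrix 120 SD8lc_n120_k8_a89da712.cert.HX = qc.HXFlat := by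
  have cast : ∀ {H H' : List ℕ} (e : H = H'),
      rowMatrix 120 H = (rowMatrix 120 H').submatrix (Fin.cast (congrArg List.length e)) id := by
    intro H H' e; subst e; rfl
  exact (cast HX_eq_rowsX).trans (rowMatrix_rowsX qc (LA := la) (LB := lb) rfl rfl)

set_option maxRecDepth 100000 in
/-- The certificate's flat `H^Z` is `qc.HZFlat`. -/
theorem rowMatrix_HZ_eq : rowMatrix 120 SD8lc_n120_k8_a89da712.cert.HZ = qc.HZFlat := by
  have cast : ∀ {H H' : List ℕ} (e : H = H'),
      rowMatrix 120 H = (rowMatrix 120 H').submatrix (Fin.cast (congrArg List.length e)) id := by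
    intro H H' e; subst e; rfl
  exact (cast HZ_eq_rowsZ).trans (rowMatrix_rowsZ qc (LA := la) (LB := lb) rfl rfl)

set_option maxRecDepth 100000 in
/-- `d^Z (qc) = 12`, transported from the census certificate (`SD8lc_n120_k8_a89da712.dZ_eq`) by `BB.Code.dZ_eq_of_flat`. -/
theorem qc_dZ : qc.css.dZ = 12 :=
  (qc.dZ_eq_of_flat (D := SD8lc_n120_k8_a89da712.cert.code (SD8lc_n120_k8_a89da712.cert.commOK_of_checkStructure SD8lc_n120_k8_a89da712.checkStructure_ok))
    rowMatrix_HX_eq rowMatrix_HZ_eq).symm.trans SD8lc_n120_k8_a89da712.dZ_eq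

set_option maxRecDepth 100000 in
/-- `k (qc) = 8`, transported from the census certificate (`SD8lc_n120_k8_a89da712.k_eq`) by `BB.Code.k_eq_of_flat`. -/
theorem qc_k : qc.k = 8 :=
  (qc.k_eq_of_flat (D := SD8lc_n120_k8_a89da712.cert.code (SD8lc_n120_k8_a89da712.cert.commOK_of_checkStructure SD8lc_n120_k8_a89da712.checkStructure_ok))
    rowMatrix_HX_eq rowMatrix_HZ_eq).symm.trans SD8lc_n120_k8_a89da712.k_eq

/-- **`QC(1 + y + y^4 + xy^9, 1 + y^26 + y^29 + xy^21)` on `ℤ_2 × ℤ_30` has parameters `[[120, 8, 12]]`** (distance exact; `BB.HasParams`) — the census row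
`SD8lc_n120_k8_a89da712` read as a statement about the construction. KERNEL. -/
theorem qc_hasParams : Summit.Ventures.QEC.BB.HasParams qc 120 8 12 :=
  BB.hasParams_of_dZ (by simp only [BB.numQubits_eq]) qc_k qc_dZ

/-- The same in the generic census vocabulary: `qc.css.IsCode 120 8 12`. -/
theorem qc_isCode : qc.css.IsCode 120 8 12 :=
  (BB.hasParams_iff_isCode (by decide)).1 qc_hasParams

set_option maxRecDepth 100000 in
/-- **The Tanner graph of `qc` is connected** (Bravyi et al. 2024 Lemma 3 / `BB.Code.tannerGraph_connected_of_unit_mem`): `x = (1,0)`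
and `y = (0,1)` are explicit combinations of exponent differences inside `A` or inside `B` (found by qec-type-05's tools/conn_cert.py,
re-checked by `decide`). Census column «connected» for this row, KERNEL. -/
theorem qc_tannerGraph_connected : qc.css.tannerGraph.Connected := by
  refine qc.tannerGraph_connected_of_unit_mem (fun h => absurd (congrFun h ((0 : Fin 2), (0 : Fin 30))) (by decide))
    (fun h => absurd (congrFun h ((0 : Fin 2), (0 : Fin 30))) (by decide)) ?_ ?_
  · have e : (((1 : Fin 2), (0 : Fin 30)) : BB.Mono 2 30) = (15 : ℕ) • ((((0 : Fin 2), (1 : Fin 30))) - (1, 9)) := by decide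
    rw [e]
    exact (AddSubgroup.nsmul_mem _ (qc.sub_mem_expDiffSubgroup_A (by decide) (by decide)) 15)
  · have e : (((0 : Fin 2), (1 : Fin 30)) : BB.Mono 2 30) = (29 : ℕ) • ((((0 : Fin 2), (0 : Fin 30))) - (0, 1)) := by decide
    rw [e]
    exact (AddSubgroup.nsmul_mem _ (qc.sub_mem_expDiffSubgroup_A (by decide) (by decide)) 29)

set_option maxRecDepth 100000 in
/-- **`qc` has a toric layout with `(μ, λ) = (10, 6)`** (Bravyi et al. 2024 Lemma 4 / `BB.Code.hasToricLayoutWith_of_exponents`): the two layout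
generators `A_iA_jᵀ ↦ (0, 1) − (0, 4)` and `B_gB_hᵀ ↦ (0, 26) − (1, 21)` generate `ℤ_2 × ℤ_30` generate the group
(explicit multiples giving `x` and `y`) and have orders `10` and `6` (product `60 = ℓm`). — both facts `decide`d as LOCAL
steps (they mention no row constant, so as separate theorems they would restate the same statement across rows). Census
layout column, KERNEL. -/
theorem qc_hasToricLayoutWith : HasToricLayoutWith 10 6 qc.css.tannerGraph := by
  have hgen : AddSubgroup.closure ({((0 : Fin 2), (1 : Fin 30)) - (0, 4), ((0 : Fin 2), (26 : Fin 30)) - (1, 21)} : Set (BB.Mono 2 30)) = ⊤ := by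
    apply BB.Code.addSubgroup_eq_top_of_unit_mem
    · have h1 := AddSubgroup.subset_closure (k := ({((0 : Fin 2), (1 : Fin 30)) - (0, 4), ((0 : Fin 2), (26 : Fin 30)) - (1, 21)} : Set (BB.Mono 2 30))) (Set.mem_insert _ _)
      have h2 := AddSubgroup.subset_closure (k := ({((0 : Fin 2), (1 : Fin 30)) - (0, 4), ((0 : Fin 2), (26 : Fin 30)) - (1, 21)} : Set (BB.Mono 2 30))) (Set.mem_insert_of_mem _ rfl)
      have e : (5 : ℕ) • (((0 : Fin 2), (1 : Fin 30)) - (0, 4)) + (3 : ℕ) • (((0 : Fin 2), (26 : Fin 30)) - (1, 21)) = (1, 0) := by decide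
      have h' := AddSubgroup.add_mem _ (AddSubgroup.nsmul_mem _ h1 5) (AddSubgroup.nsmul_mem _ h2 3)
      rw [e] at h'
      exact h'
    · have h1 := AddSubgroup.subset_closure (k := ({((0 : Fin 2), (1 : Fin 30)) - (0, 4), ((0 : Fin 2), (26 : Fin 30)) - (1, 21)} : Set (BB.Mono 2 30))) (Set.mem_insert _ _)
      have h2 := AddSubgroup.subset_closure (k := ({((0 : Fin 2), (1 : Fin 30)) - (0, 4), ((0 : Fin 2), (26 : Fin 30)) - (1, 21)} : Set (BB.Mono 2 30))) (Set.mem_insert_of_mem _ rfl)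
      have e : (3 : ℕ) • (((0 : Fin 2), (1 : Fin 30)) - (0, 4)) + (2 : ℕ) • (((0 : Fin 2), (26 : Fin 30)) - (1, 21)) = (0, 1) := by decide
      have h' := AddSubgroup.add_mem _ (AddSubgroup.nsmul_mem _ h1 3) (AddSubgroup.nsmul_mem _ h2 2)
      rw [e] at h'
      exact h'
  have hord : addOrderOf (((0 : Fin 2), (1 : Fin 30)) - (0, 4)) = 10 ∧ addOrderOf (((0 : Fin 2), (26 : Fin 30)) - (1, 21)) = 6 :=
    ⟨(addOrderOf_eq_iff (by norm_num)).mpr (by decide), (addOrderOf_eq_iff (by norm_num)).mpr (by decide)⟩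
  have h := qc.hasToricLayoutWith_of_exponents (g := ((0 : Fin 2), (1 : Fin 30))) (g' := (0, 4))
    (h := ((0 : Fin 2), (26 : Fin 30))) (h' := (1, 21)) (by decide) (by decide) (by decide) (by decide)
    hgen (by rw [hord.1, hord.2])
  rwa [hord.1, hord.2] at h

/-- `qc` has a toric layout. KERNEL. -/
theorem qc_hasToricLayout : HasToricLayout qc.css.tannerGraph :=
  ⟨10, 6, by norm_num, by norm_num, qc_hasToricLayoutWith⟩

end Summit.Ventures.QEC.Census.SD8lc_n120_k8_a89da712

namespace Summit.Ventures.QEC.Census.SD8lc_n130_k10_8438ec22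

open Matrix Literature.InformationTheory.QuantumCodes BBRows

/-- Monomials of `A = 1 + y + y^6 + y^25` (construction `A_terms = [[0, 0], [0, 1], [0, 6], [0, 25]]`, from the census generator file `census/search-3/gens/sd8/SD8lc_n130_k10_8438ec22.json` (matrix_sha256 `8438ec22e5c51005…`; `A = 1+y+y^6+y^25`, `B = 1+y^40+y^59+y^64`)). DATA. -/
def la : List (BB.Mono 1 65) := [(Fin.ofNat 1 0, Fin.ofNat 65 0), (Fin.ofNat 1 0, Fin.ofNat 65 1), (Fin.ofNat 1 0, Fin.ofNat 65 6), (Fin.ofNat 1 0, Fin.ofNat 65 25)]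

/-- Monomials of `B = 1 + y^40 + y^59 + y^64` (construction `B_terms = [[0, 0], [0, 40], [0, 59], [0, 64]]`). DATA. -/
def lb : List (BB.Mono 1 65) := [(Fin.ofNat 1 0, Fin.ofNat 65 0), (Fin.ofNat 1 0, Fin.ofNat 65 40), (Fin.ofNat 1 0, Fin.ofNat 65 59), (Fin.ofNat 1 0, Fin.ofNat 65 64)]

/-- The census row's code as a TYPED two-block code `QC(1 + y + y^6 + y^25, 1 + y^40 + y^59 + y^64)` on `ℤ_1 × ℤ_65` (`BB.Code 1 65`). (definition) -/
def qc : BB.Code 1 65 := ⟨polyL la, polyL lb⟩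

set_option maxRecDepth 100000 in
/-- INDEX IDENTITY, `X` side, in the kernel: the certificate's `H^X` rows ARE the `X`-check words of `qc` (`decide +kernel`). -/
theorem HX_eq_rowsX : SD8lc_n130_k10_8438ec22.cert.HX = rowsX la lb := by
  decide +kernel

set_option maxRecDepth 100000 in
/-- INDEX IDENTITY, `Z` side. -/
theorem HZ_eq_rowsZ : SD8lc_n130_k10_8438ec22.cert.HZ = rowsZ la lb := by
  decide +kernel

set_option maxRecDepth 100000 in
/-- The certificate's flat `H^X` is `qc.HXFlat`. -/
theorem rowMatrix_HX_eq : rowMatrix 130 SD8lc_n130_k10_8438ec22.cert.HX = qc.HXFlat := by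
  have cast : ∀ {H H' : List ℕ} (e : H = H'),
      rowMatrix 130 H = (rowMatrix 130 H').submatrix (Fin.cast (congrArg List.length e)) id := by
    intro H H' e; subst e; rfl
  exact (cast HX_eq_rowsX).trans (rowMatrix_rowsX qc (LA := la) (LB := lb) rfl rfl)

set_option maxRecDepth 100000 in
/-- The certificate's flat `H^Z` is `qc.HZFlat`. -/
theorem rowMatrix_HZ_eq : rowMatrix 130 SD8lc_n130_k10_8438ec22.cert.HZ = qc.HZFlat := by
  have cast : ∀ {H H' : List ℕ} (e : H = H'),
      rowMatrix 130 H = (rowMatrix 130 H').submatrix (Fin.cast (congrArg List.length e)) id := by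
    intro H H' e; subst e; rfl
  exact (cast HZ_eq_rowsZ).trans (rowMatrix_rowsZ qc (LA := la) (LB := lb) rfl rfl)

set_option maxRecDepth 100000 in
/-- `d^Z (qc) = 10`, transported from the census certificate (`SD8lc_n130_k10_8438ec22.dZ_eq`) by `BB.Code.dZ_eq_of_flat`. -/
theorem qc_dZ : qc.css.dZ = 10 :=
  (qc.dZ_eq_of_flat (D := SD8lc_n130_k10_8438ec22.cert.code (SD8lc_n130_k10_8438ec22.cert.commOK_of_checkStructure SD8lc_n130_k10_8438ec22.checkStructure_ok))
    rowMatrix_HX_eq rowMatrix_HZ_eq).symm.trans SD8lc_n130_k10_8438ec22.dZ_eq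

set_option maxRecDepth 100000 in
/-- `k (qc) = 10`, transported from the census certificate (`SD8lc_n130_k10_8438ec22.k_eq`) by `BB.Code.k_eq_of_flat`. -/
theorem qc_k : qc.k = 10 :=
  (qc.k_eq_of_flat (D := SD8lc_n130_k10_8438ec22.cert.code (SD8lc_n130_k10_8438ec22.cert.commOK_of_checkStructure SD8lc_n130_k10_8438ec22.checkStructure_ok))
    rowMatrix_HX_eq rowMatrix_HZ_eq).symm.trans SD8lc_n130_k10_8438ec22.k_eq

/-- **`QC(1 + y + y^6 + y^25, 1 + y^40 + y^59 + y^64)` on `ℤ_1 × ℤ_65` has parameters `[[130, 10, 10]]`** (distance exact; `BB.HasParams`) — the census row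
`SD8lc_n130_k10_8438ec22` read as a statement about the construction. KERNEL. -/
theorem qc_hasParams : Summit.Ventures.QEC.BB.HasParams qc 130 10 10 :=
  BB.hasParams_of_dZ (by simp only [BB.numQubits_eq]) qc_k qc_dZ

/-- The same in the generic census vocabulary: `qc.css.IsCode 130 10 10`. -/
theorem qc_isCode : qc.css.IsCode 130 10 10 :=
  (BB.hasParams_iff_isCode (by decide)).1 qc_hasParams

set_option maxRecDepth 100000 in
/-- **The Tanner graph of `qc` is connected** (Bravyi et al. 2024 Lemma 3 / `BB.Code.tannerGraph_connected_of_unit_mem`): `x = (1,0)`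
and `y = (0,1)` are explicit combinations of exponent differences inside `A` or inside `B` (found by qec-type-05's tools/conn_cert.py,
re-checked by `decide`). Census column «connected» for this row, KERNEL. -/
theorem qc_tannerGraph_connected : qc.css.tannerGraph.Connected := by
  refine qc.tannerGraph_connected_of_unit_mem (fun h => absurd (congrFun h ((0 : Fin 1), (0 : Fin 65))) (by decide))
    (fun h => absurd (congrFun h ((0 : Fin 1), (0 : Fin 65))) (by decide)) ?_ ?_
  · have e : (((1 : Fin 1), (0 : Fin 65)) : BB.Mono 1 65) = (65 : ℕ) • ((((0 : Fin 1), (0 : Fin 65))) - (0, 1)) := by decide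
    rw [e]
    exact (AddSubgroup.nsmul_mem _ (qc.sub_mem_expDiffSubgroup_A (by decide) (by decide)) 65)
  · have e : (((0 : Fin 1), (1 : Fin 65)) : BB.Mono 1 65) = (64 : ℕ) • ((((0 : Fin 1), (0 : Fin 65))) - (0, 1)) := by decide
    rw [e]
    exact (AddSubgroup.nsmul_mem _ (qc.sub_mem_expDiffSubgroup_A (by decide) (by decide)) 64)

end Summit.Ventures.QEC.Census.SD8lc_n130_k10_8438ec22

namespace Summit.Ventures.QEC.Census.SD8lc_n132_k8_57db3d9b

open Matrix Literature.InformationTheory.QuantumCodes BBRows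

/-- Monomials of `A = 1 + y + y^4 + y^15` (construction `A_terms = [[0, 0], [0, 1], [0, 4], [0, 15]]`, from the census generator file `census/search-3/gens/sd8/SD8lc_n132_k8_57db3d9b.json` (matrix_sha256 `57db3d9b357f3d3d…`; `A = 1+y+y^4+y^15`, `B = 1+y^51+y^62+y^65`)). DATA. -/
def la : List (BB.Mono 1 66) := [(Fin.ofNat 1 0, Fin.ofNat 66 0), (Fin.ofNat 1 0, Fin.ofNat 66 1), (Fin.ofNat 1 0, Fin.ofNat 66 4), (Fin.ofNat 1 0, Fin.ofNat 66 15)]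

/-- Monomials of `B = 1 + y^51 + y^62 + y^65` (construction `B_terms = [[0, 0], [0, 51], [0, 62], [0, 65]]`). DATA. -/
def lb : List (BB.Mono 1 66) := [(Fin.ofNat 1 0, Fin.ofNat 66 0), (Fin.ofNat 1 0, Fin.ofNat 66 51), (Fin.ofNat 1 0, Fin.ofNat 66 62), (Fin.ofNat 1 0, Fin.ofNat 66 65)]

/-- The census row's code as a TYPED two-block code `QC(1 + y + y^4 + y^15, 1 + y^51 + y^62 + y^65)` on `ℤ_1 × ℤ_66` (`BB.Code 1 66`). (definition) -/
def qc : BB.Code 1 66 := ⟨polyL la, polyL lb⟩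

set_option maxRecDepth 100000 in
/-- INDEX IDENTITY, `X` side, in the kernel: the certificate's `H^X` rows ARE the `X`-check words of `qc` (`decide +kernel`). -/
theorem HX_eq_rowsX : SD8lc_n132_k8_57db3d9b.cert.HX = rowsX la lb := by
  decide +kernel

set_option maxRecDepth 100000 in
/-- INDEX IDENTITY, `Z` side. -/
theorem HZ_eq_rowsZ : SD8lc_n132_k8_57db3d9b.cert.HZ = rowsZ la lb := by
  decide +kernel

set_option maxRecDepth 100000 in
/-- The certificate's flat `H^X` is `qc.HXFlat`. -/
theorem rowMatrix_HX_eq : rowMatrix 132 SD8lc_n132_k8_57db3d9b.cert.HX = qc.HXFlat := by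
  have cast : ∀ {H H' : List ℕ} (e : H = H'),
      rowMatrix 132 H = (rowMatrix 132 H').submatrix (Fin.cast (congrArg List.length e)) id := by
    intro H H' e; subst e; rfl
  exact (cast HX_eq_rowsX).trans (rowMatrix_rowsX qc (LA := la) (LB := lb) rfl rfl)

set_option maxRecDepth 100000 in
/-- The certificate's flat `H^Z` is `qc.HZFlat`. -/
theorem rowMatrix_HZ_eq : rowMatrix 132 SD8lc_n132_k8_57db3d9b.cert.HZ = qc.HZFlat := by
  have cast : ∀ {H H' : List ℕ} (e : H = H'),
      rowMatrix 132 H = (rowMatrix 132 H').submatrix (Fin.cast (congrArg List.length e)) id := by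
    intro H H' e; subst e; rfl
  exact (cast HZ_eq_rowsZ).trans (rowMatrix_rowsZ qc (LA := la) (LB := lb) rfl rfl)

set_option maxRecDepth 100000 in
/-- `d^Z (qc) = 12`, transported from the census certificate (`SD8lc_n132_k8_57db3d9b.dZ_eq`) by `BB.Code.dZ_eq_of_flat`. -/
theorem qc_dZ : qc.css.dZ = 12 :=
  (qc.dZ_eq_of_flat (D := SD8lc_n132_k8_57db3d9b.cert.code (SD8lc_n132_k8_57db3d9b.cert.commOK_of_checkStructure SD8lc_n132_k8_57db3d9b.checkStructure_ok))
    rowMatrix_HX_eq rowMatrix_HZ_eq).symm.trans SD8lc_n132_k8_57db3d9b.dZ_eq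

set_option maxRecDepth 100000 in
/-- `k (qc) = 8`, transported from the census certificate (`SD8lc_n132_k8_57db3d9b.k_eq`) by `BB.Code.k_eq_of_flat`. -/
theorem qc_k : qc.k = 8 :=
  (qc.k_eq_of_flat (D := SD8lc_n132_k8_57db3d9b.cert.code (SD8lc_n132_k8_57db3d9b.cert.commOK_of_checkStructure SD8lc_n132_k8_57db3d9b.checkStructure_ok))
    rowMatrix_HX_eq rowMatrix_HZ_eq).symm.trans SD8lc_n132_k8_57db3d9b.k_eq

/-- **`QC(1 + y + y^4 + y^15, 1 + y^51 + y^62 + y^65)` on `ℤ_1 × ℤ_66` has parameters `[[132, 8, 12]]`** (distance exact; `BB.HasParams`) — the census row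
`SD8lc_n132_k8_57db3d9b` read as a statement about the construction. KERNEL. -/
theorem qc_hasParams : Summit.Ventures.QEC.BB.HasParams qc 132 8 12 :=
  BB.hasParams_of_dZ (by simp only [BB.numQubits_eq]) qc_k qc_dZ

/-- The same in the generic census vocabulary: `qc.css.IsCode 132 8 12`. -/
theorem qc_isCode : qc.css.IsCode 132 8 12 :=
  (BB.hasParams_iff_isCode (by decide)).1 qc_hasParams

set_option maxRecDepth 100000 in
/-- **The Tanner graph of `qc` is connected** (Bravyi et al. 2024 Lemma 3 / `BB.Code.tannerGraph_connected_of_unit_mem`): `x = (1,0)`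
and `y = (0,1)` are explicit combinations of exponent differences inside `A` or inside `B` (found by qec-type-05's tools/conn_cert.py,
re-checked by `decide`). Census column «connected» for this row, KERNEL. -/
theorem qc_tannerGraph_connected : qc.css.tannerGraph.Connected := by
  refine qc.tannerGraph_connected_of_unit_mem (fun h => absurd (congrFun h ((0 : Fin 1), (0 : Fin 66))) (by decide))
    (fun h => absurd (congrFun h ((0 : Fin 1), (0 : Fin 66))) (by decide)) ?_ ?_
  · have e : (((1 : Fin 1), (0 : Fin 66)) : BB.Mono 1 66) = (66 : ℕ) • ((((0 : Fin 1), (0 : Fin 66))) - (0, 1)) := by decide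
    rw [e]
    exact (AddSubgroup.nsmul_mem _ (qc.sub_mem_expDiffSubgroup_A (by decide) (by decide)) 66)
  · have e : (((0 : Fin 1), (1 : Fin 66)) : BB.Mono 1 66) = (65 : ℕ) • ((((0 : Fin 1), (0 : Fin 66))) - (0, 1)) := by decide
    rw [e]
    exact (AddSubgroup.nsmul_mem _ (qc.sub_mem_expDiffSubgroup_A (by decide) (by decide)) 65)

end Summit.Ventures.QEC.Census.SD8lc_n132_k8_57db3d9b
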